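import Summits.Ventures.PercRepro.ProfilePointedCircuitClasses

/-!
# PercRepro — THE CORE CLASS `#C = 2` OF THE BOTTOM-LEVEL PER-CIRCUIT CLAIM AT NULLITY 4: THE LOCAL LYM
(p5, gen 36; `proofs/P5-GM1.md` §52(b), the `#D = 3` case)

The closure lemma `mem_clF_sdiff_of_forall_notMem_fundC` (`x ∈ cl(W ∖ S)` when `S` misses the fundamental circuit), two
rank tools (`rk_sdiff_add_card_le_of_forall_coloop`, `exists_not_coloop_of_four`), the «at most two invalid points» lemma
`two_le_card_filter_valid`, and the three-type injection behind the LOCAL LYM of the class `#C = 2`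
(`local_lym_of_card_eq_two`): on every containment edge `W ⊆ V` of the class, the demands below `V` inject into the
units above `W`.
-/

open scoped Matroid

namespace PercRepro.Cogirth

open Finset ThmH Skew Shadow Profile

variable {α : Type} [DecidableEq α] {N : Matroid α} [N.Finite]

section Core

/-- **`x ∈ cl(W ∖ S)` WHENEVER `S ⊆ W` MISSES THE FUNDAMENTAL CIRCUIT**: by induction on `S`, submodularity on
`(W ∖ S) + x` and `(W − w) + x` (union `W + x`, intersection `(W ∖ (S + w)) + x`) forces `x ∈ cl(W ∖ (S + w))`. -/
theorem mem_clF_sdiff_of_forall_notMem_fundC {x : α} {W : Finset α} (hx : x ∈ gr N) (hWg : W ⊆ gr N)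
    (hWrk : rk N W = W.card) (hxcl : x ∈ clF N W) :
    ∀ S : Finset α, S ⊆ W → (∀ w ∈ S, w ∉ fundC N W x) → x ∈ clF N (W \ S) := by
  intro S
  induction S using Finset.induction_on with
  | empty => intro _ _; rw [sdiff_empty]; exact hxcl
  | insert w S hwS ih =>
    intro hSW hS
    have hSW' : S ⊆ W := (subset_insert w S).trans hSW
    have hwW : w ∈ W := hSW (mem_insert_self w S)
    have hA := ih hSW' (fun w' hw' => hS w' (mem_insert_of_mem hw'))
    have hB : x ∈ clF N (W.erase w) := by
      have : w ∉ fundC N W x := hS w (mem_insert_self w S)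
      unfold fundC at this
      rw [mem_filter, not_and] at this
      exact not_not.1 (this hwW)
    have hAg : W \ S ⊆ gr N := sdiff_subset.trans hWg
    have hBg : W.erase w ⊆ gr N := (erase_subset w W).trans hWg
    have hIg : W \ insert w S ⊆ gr N := sdiff_subset.trans hWg
    have rA : rk N (insert x (W \ S)) = rk N (W \ S) := by rw [rk_insert_eq hx hAg, if_pos hA]
    have rB : rk N (insert x (W.erase w)) = rk N (W.erase w) := by rw [rk_insert_eq hx hBg, if_pos hB]
    have rW : rk N (insert x W) = rk N W := by rw [rk_insert_eq hx hWg, if_pos hxcl]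
    have rAc : rk N (W \ S) = (W \ S).card := rk_eq_card_of_subset_of_rk_eq_card sdiff_subset hWrk
    have rBc : rk N (W.erase w) = W.card - 1 := by
      rw [rk_eq_card_of_subset_of_rk_eq_card (erase_subset w W) hWrk, card_erase_of_mem hwW]
    have rIc : rk N (W \ insert w S) = (W \ insert w S).card :=
      rk_eq_card_of_subset_of_rk_eq_card sdiff_subset hWrk
    have hsm := rk_union_add_rk_inter_le (M := N) (insert x (W \ S)) (insert x (W.erase w))
    have hU : insert x (W \ S) ∪ insert x (W.erase w) = insert x W := by
      ext a
      simp only [mem_union, mem_insert, mem_sdiff, mem_erase]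
      constructor
      · rintro (⟨h | ⟨hW', _⟩⟩ | ⟨h | ⟨_, hW'⟩⟩)
        · exact Or.inl h
        · exact Or.inr hW'
        · exact Or.inl h
        · exact Or.inr hW'
      · rintro (h | hW')
        · exact Or.inl (Or.inl h)
        · by_cases haw : a = w
          · subst haw
            exact Or.inl (Or.inr ⟨hW', hwS⟩)
          · exact Or.inr (Or.inr ⟨haw, hW'⟩)
    have hI : insert x (W \ S) ∩ insert x (W.erase w) = insert x (W \ insert w S) := by
      ext a
      simp only [mem_inter, mem_insert, mem_sdiff, mem_erase]
      constructor
      · rintro ⟨h1 | ⟨hW', hS⟩, h2 | ⟨hne, _⟩⟩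
        · exact Or.inl h1
        · exact Or.inl h1
        · exact Or.inl h2
        · exact Or.inr ⟨hW', fun h => h.elim hne hS⟩
      · rintro (h | ⟨hW', hS⟩)
        · exact ⟨Or.inl h, Or.inl h⟩
        · exact ⟨Or.inr ⟨hW', fun h => hS (Or.inr h)⟩, Or.inr ⟨fun h => hS (Or.inl h), hW'⟩⟩
    rw [hU, hI, rA, rB, rW, rAc, rBc, hWrk] at hsm
    have hcardI : (W \ insert w S).card + 1 = (W \ S).card := by
      rw [sdiff_insert, card_erase_of_mem (mem_sdiff.2 ⟨hwW, hwS⟩)]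
      have : 1 ≤ (W \ S).card := card_pos.2 ⟨w, mem_sdiff.2 ⟨hwW, hwS⟩⟩
      omega
    have hW1 : 1 ≤ W.card := card_pos.2 ⟨w, hwW⟩
    -- `rk((W ∖ S') + x) ≤ #(W ∖ S')`, so `x ∈ cl(W ∖ S')`
    by_contra h
    have rI : rk N (insert x (W \ insert w S)) = rk N (W \ insert w S) + 1 := by
      rw [rk_insert_eq hx hIg, if_neg h]
    rw [rI, rIc] at hsm
    omega

/-- **COLOOPS SUBTRACT**: for `S` a set of coloops of `X` (`ρ(X − t) < ρ(X)` for `t ∈ S`), `ρ(X ∖ S) + #S ≤ ρ(X)`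
(induction on `S`, submodularity on `X ∖ S` and `X − t`). -/
theorem rk_sdiff_add_card_le_of_forall_coloop {X : Finset α} :
    ∀ S : Finset α, S ⊆ X → (∀ t ∈ S, rk N (X.erase t) < rk N X) → rk N (X \ S) + S.card ≤ rk N X := by
  intro S
  induction S using Finset.induction_on with
  | empty => intro _ _; rw [sdiff_empty, card_empty]; omega
  | insert t S htS ih =>
    intro hSX hS
    have hSX' : S ⊆ X := (subset_insert t S).trans hSX
    have htX : t ∈ X := hSX (mem_insert_self t S)
    have ih' := ih hSX' (fun t' ht' => hS t' (mem_insert_of_mem ht'))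
    have ht := hS t (mem_insert_self t S)
    have hsm := rk_union_add_rk_inter_le (M := N) (X \ S) (X.erase t)
    have hU : X \ S ∪ X.erase t = X := by
      ext a
      simp only [mem_union, mem_sdiff, mem_erase]
      constructor
      · rintro (⟨h, _⟩ | ⟨_, h⟩) <;> exact h
      · intro h
        by_cases hat : a = t
        · exact Or.inl ⟨h, hat ▸ htS⟩
        · exact Or.inr ⟨hat, h⟩
    have hI : X \ S ∩ X.erase t = X \ insert t S := by
      ext a
      simp only [mem_inter, mem_sdiff, mem_erase, mem_insert, not_or]
      tauto
    rw [hU, hI] at hsm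
    rw [card_insert_of_notMem htS]
    omega

/-- In a `4`-set `T ⊆ X` with `ρ(X ∖ T) + 3 ≥ ρ(X)`, some point is not a coloop of `X`. -/
theorem exists_not_coloop_of_four {X T : Finset α} (hT : T ⊆ X) (hT4 : T.card = 4)
    (hrk : rk N X ≤ rk N (X \ T) + 3) : ∃ t ∈ T, rk N (X.erase t) = rk N X := by
  by_contra h
  have hall : ∀ t ∈ T, rk N (X.erase t) < rk N X := by
    intro t ht
    have h1 : rk N (X.erase t) ≤ rk N X := rk_le_rk_of_subset_finset (erase_subset t X)
    exact lt_of_le_of_ne h1 (fun heq => h ⟨t, ht, heq⟩)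
  have := rk_sdiff_add_card_le_of_forall_coloop T hT hall
  omega

/-- **AT MOST TWO INVALID POINTS** (§52(b), case (iii)): for a unit `V` of a class `C` with `x ∈ cl C`, a point
`q' ∈ V ∖ C` with `E − q'` spanning, and `T := (E − x) ∖ V` (four points), at least two points `t ∈ T` satisfy
`t ∉ cl(V − q')` — otherwise `E − q' − t₄` lies in `cl(V − q')`, of rank `#V − 1`, while its rank is `≥ ρ(E) − 1`. -/
theorem two_le_card_filter_valid {x q' : α} {C V : Finset α} (hVg : V ⊆ gr N) (hVrk : rk N V = V.card)
    (_hxV : x ∉ V) (hCV : C ⊆ V) (hxC : x ∈ clF N C) (hq'V : q' ∈ V) (hq'C : q' ∉ C)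
    (hq : rk N ((gr N).erase q') = rk N (gr N)) (hT4 : ((gr N).erase x \ V).card = 4)
    (hVcard : V.card + 5 = (gr N).card) (hn : (gr N).card = rk N (gr N) + 4) (hR : 6 ≤ rk N (gr N)) :
    2 ≤ (((gr N).erase x \ V).filter (fun t => t ∉ clF N (V.erase q'))).card := by
  by_contra hlt
  have hlt : (((gr N).erase x \ V).filter (fun t => t ∉ clF N (V.erase q'))).card < 2 := Nat.lt_of_not_le hlt
  set T := (gr N).erase x \ V with hT
  set Tv := T.filter (fun t => t ∉ clF N (V.erase q')) with hTv
  -- a point `t₄ ∈ T` with `Tv ⊆ {t₄}`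
  have hex : ∃ t₄ ∈ T, Tv ⊆ {t₄} := by
    rcases Tv.eq_empty_or_nonempty with hemp | ⟨t, ht⟩
    · obtain ⟨t, ht⟩ : T.Nonempty := card_pos.1 (by omega)
      exact ⟨t, ht, by rw [hemp]; exact empty_subset _⟩
    · refine ⟨t, (mem_filter.1 ht).1, ?_⟩
      intro t' ht'
      rw [mem_singleton]
      have h2 : Tv.card ≤ 1 := by omega
      exact card_le_one.1 h2 t' ht' t ht
  obtain ⟨t₄, ht₄T, hTv₄⟩ := hex
  have ht₄g : t₄ ∈ gr N := (mem_erase.1 (mem_sdiff.1 ht₄T).1).2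
  have ht₄V : t₄ ∉ V := (mem_sdiff.1 ht₄T).2
  have ht₄q : t₄ ≠ q' := fun h => ht₄V (h ▸ hq'V)
  have hxg : x ∈ gr N := clF_subset_gr C hxC
  -- `E − q' − t₄ ⊆ cl(V − q')`
  have hVe : V.erase q' ⊆ gr N := (erase_subset _ _).trans hVg
  have hCVe : C ⊆ V.erase q' := by
    intro c hc
    rw [mem_erase]
    exact ⟨fun h => hq'C (h ▸ hc), hCV hc⟩
  have hsub : ((gr N).erase q').erase t₄ ⊆ clF N (V.erase q') := by
    intro a ha
    rw [mem_erase, mem_erase] at ha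
    obtain ⟨hat, haq, hag⟩ := ha
    by_cases haV : a ∈ V
    · exact subset_clF_self_of_subset_gr hVe (mem_erase.2 ⟨haq, haV⟩)
    · by_cases hax : a = x
      · rw [hax]
        exact mem_clF_of_subset hCVe hxC
      · have haT : a ∈ T := mem_sdiff.2 ⟨mem_erase.2 ⟨hax, hag⟩, haV⟩
        by_contra hacl
        have : a ∈ Tv := mem_filter.2 ⟨haT, hacl⟩
        exact hat (mem_singleton.1 (hTv₄ this))
  have h1 : rk N (((gr N).erase q').erase t₄) ≤ rk N (V.erase q') := by
    have := rk_le_rk_of_subset_finset (M := N) hsub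
    rwa [rk_clF_eq_rk] at this
  have h2 : rk N (V.erase q') = V.card - 1 := by
    rw [rk_eq_card_of_subset_of_rk_eq_card (erase_subset _ _) hVrk, card_erase_of_mem hq'V]
  have h3 : rk N ((gr N).erase q') ≤ rk N (((gr N).erase q').erase t₄) + 1 := by
    have e : insert t₄ (((gr N).erase q').erase t₄) = (gr N).erase q' :=
      insert_erase (mem_erase.2 ⟨ht₄q, ht₄g⟩)
    have := rk_insert_eq (M := N) ht₄g ((erase_subset _ _).trans (erase_subset _ _)) (e := t₄)
      (X := ((gr N).erase q').erase t₄)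
    rw [e] at this
    rw [this]
    split_ifs <;> omega
  have h4 : rk N (gr N) ≤ rk N (((gr N).erase q').erase t₄) + 1 := hq ▸ h3
  have h5 : rk N (((gr N).erase q').erase t₄) ≤ V.card - 1 := h1.trans (le_of_eq h2)
  have h6 : 5 ≤ V.card := by
    have := hn
    have := hVcard
    have := hR
    omega
  omega

/-- **THE TYPE-(ii) DEMANDS** (`W' ∩ W = C`): `W' ↦ (E − x) ∖ ((W' ∖ C) + t₁ + t₂)` with `t₁ ∈ T` not a coloop of
`E ∖ (W' ∖ C)`; the image meets `T` in two points and determines `W' ∖ C = V ∖ image`. -/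
theorem card_typeII_le
    (hn : (gr N).card = rk N (gr N) + 4) (x : α) {C W V : Finset α} (Dv Uw : Finset (Finset α))
    (hC : C.card = 2) (hWcard : W.card = 4) (_hxV : x ∉ V) (hVg : V ⊆ gr N) (hVE : V ⊆ (gr N).erase x) (hVcard : V.card = (gr N).card - 5) (hVrk : rk N V = V.card)
    (hCW : C ⊆ W) (hT4 : ((gr N).erase x \ V).card = 4) (hTg : (gr N).erase x \ V ⊆ gr N)
    (hTV : ∀ t ∈ (gr N).erase x \ V, t ∉ V) (hTW : ∀ t ∈ (gr N).erase x \ V, t ∉ W)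
    (hdem' : ∀ W' ∈ Dv, C ⊆ W' ∧ W'.card = 4 ∧ W' ⊆ V ∧ rk N (gr N \ W') = (gr N \ W').card)
    (hspan' : ∀ W' ∈ Dv, ∀ S ⊆ W', rk N (gr N \ S) = rk N (gr N))
    (hunit' : ∀ T' : Finset α, T' ⊆ (gr N).erase x \ W → T'.card = 4 →
      rk N (gr N) ≤ rk N (gr N \ T') + 1 → (gr N).erase x \ T' ∈ Uw) :
    (Dv.filter (fun W' => ¬ W' = W ∧ ¬ (W' ∩ W).card = 3)).card ≤
      (Uw.filter (fun V' => (V' ∩ ((gr N).erase x \ V)).card = 2)).card := by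
  apply card_le_card_of_forall_subsingleton (fun W' V' => V \ V' = W' \ C)
  · intro W' hW'
    rw [mem_filter] at hW'
    obtain ⟨hW'Dv, hne, h3⟩ := hW'
    obtain ⟨hCW', hc', hsub', hcompl'⟩ := hdem' W' hW'Dv
    -- `W' ∩ W = C`: the intersection contains `C`, has at most `3` points unless `W' = W`, and is not `3`
    have hint : W' ∩ W = C := by
      have hsubI : C ⊆ W' ∩ W := subset_inter hCW' hCW
      have hle4 : (W' ∩ W).card ≤ 4 := (card_le_card inter_subset_left).trans (le_of_eq hc')
      have hne4 : (W' ∩ W).card ≠ 4 := by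
        intro h4
        apply hne
        have hWsub : W' ⊆ W := by
          have : W' ∩ W = W' := eq_of_subset_of_card_le inter_subset_left (by omega)
          rw [← this]; exact inter_subset_right
        exact eq_of_subset_of_card_le hWsub (by omega)
      have hge2 : 2 ≤ (W' ∩ W).card := hC ▸ card_le_card hsubI
      exact (eq_of_subset_of_card_le hsubI (by omega)).symm
    have hPV : W' \ C ⊆ V := sdiff_subset.trans hsub'
    have hPW : ∀ a ∈ W' \ C, a ∉ W := by
      intro a ha haW
      have : a ∈ W' ∩ W := mem_inter.2 ⟨(mem_sdiff.1 ha).1, haW⟩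
      rw [hint] at this
      exact (mem_sdiff.1 ha).2 this
    have hP2 : (W' \ C).card = 2 := by rw [card_sdiff_of_subset hCW']; omega
    -- `t₁ ∈ T` not a coloop of `E ∖ (W' ∖ C)`
    have hTX : (gr N).erase x \ V ⊆ gr N \ (W' \ C) := fun t ht =>
      mem_sdiff.2 ⟨hTg ht, fun h => hTV t ht (hPV h)⟩
    have hrkX : rk N (gr N \ (W' \ C)) ≤ rk N ((gr N \ (W' \ C)) \ ((gr N).erase x \ V)) + 3 := by
      have h1 : rk N (gr N \ (W' \ C)) = rk N (gr N) := hspan' W' hW'Dv (W' \ C) sdiff_subset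
      have h2 : V \ (W' \ C) ⊆ (gr N \ (W' \ C)) \ ((gr N).erase x \ V) := by
        intro a ha
        rw [mem_sdiff] at ha ⊢
        exact ⟨mem_sdiff.2 ⟨hVg ha.1, ha.2⟩, fun h => hTV a h ha.1⟩
      have h3 : rk N (V \ (W' \ C)) = (V \ (W' \ C)).card :=
        rk_eq_card_of_subset_of_rk_eq_card sdiff_subset hVrk
      have h4 := rk_le_rk_of_subset_finset (M := N) h2
      rw [h3, card_sdiff_of_subset hPV, hVcard, hP2] at h4
      omega
    obtain ⟨t₁, ht₁T, ht₁⟩ := exists_not_coloop_of_four hTX hT4 hrkX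
    obtain ⟨t₂, ht₂T, ht₂₁⟩ := exists_mem_notMem_of_card_lt_card
      (show ({t₁} : Finset α).card < ((gr N).erase x \ V).card by rw [card_singleton]; omega)
    rw [mem_singleton] at ht₂₁
    -- the hole `T' := (W' ∖ C) + t₁ + t₂` and the unit `(E − x) ∖ T'`
    set T' := (W' \ C) ∪ {t₁, t₂} with hT'
    have hT'S : T' ⊆ (gr N).erase x \ W := by
      intro a ha
      rw [hT', mem_union, mem_insert, mem_singleton] at ha
      rw [mem_sdiff]
      rcases ha with ha | rfl | rfl
      · exact ⟨hVE (hPV ha), hPW a ha⟩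
      · exact ⟨(mem_sdiff.1 ht₁T).1, hTW _ ht₁T⟩
      · exact ⟨(mem_sdiff.1 ht₂T).1, hTW _ ht₂T⟩
    have hT'4 : T'.card = 4 := by
      rw [hT', card_union_of_disjoint, hP2, card_pair (fun h => ht₂₁ h.symm)]
      rw [disjoint_left]
      intro a ha hb
      rw [mem_insert, mem_singleton] at hb
      rcases hb with rfl | rfl
      · exact hTV _ ht₁T (hPV ha)
      · exact hTV _ ht₂T (hPV ha)
    have hrkT' : rk N (gr N) ≤ rk N (gr N \ T') + 1 := by
      have e1 : gr N \ T' = ((gr N \ (W' \ C)).erase t₁).erase t₂ := by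
        rw [hT']
        ext a
        simp only [mem_sdiff, mem_erase, mem_union, mem_insert, mem_singleton, not_or]
        tauto
      have h1 : rk N (gr N \ (W' \ C)) = rk N (gr N) := hspan' W' hW'Dv (W' \ C) sdiff_subset
      have ht₂X : t₂ ∈ (gr N \ (W' \ C)).erase t₁ :=
        mem_erase.2 ⟨ht₂₁, mem_sdiff.2 ⟨hTg ht₂T, fun h => hTV t₂ ht₂T (hPV h)⟩⟩
      have e2 : insert t₂ (((gr N \ (W' \ C)).erase t₁).erase t₂) = (gr N \ (W' \ C)).erase t₁ :=
        insert_erase ht₂X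
      have h2 := rk_insert_eq (M := N) (hTg ht₂T) ((erase_subset _ _).trans ((erase_subset _ _).trans sdiff_subset))
        (e := t₂) (X := ((gr N \ (W' \ C)).erase t₁).erase t₂)
      rw [e2] at h2
      rw [e1, ← h1, ← ht₁, h2]
      split_ifs <;> omega
    have hmem := hunit' T' hT'S hT'4 hrkT'
    refine ⟨(gr N).erase x \ T', ?_, ?_⟩
    · rw [mem_filter]
      refine ⟨hmem, ?_⟩
      have e : ((gr N).erase x \ T') ∩ ((gr N).erase x \ V) = ((gr N).erase x \ V) \ {t₁, t₂} := by
        rw [hT']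
        ext a
        simp only [mem_inter, mem_sdiff, mem_union, mem_insert, mem_singleton, not_or]
        constructor
        · rintro ⟨⟨hax, haP, hat⟩, _, haV⟩
          exact ⟨⟨hax, haV⟩, hat⟩
        · rintro ⟨⟨hax, haV⟩, hat⟩
          exact ⟨⟨hax, fun h => haV (hPV (mem_sdiff.2 h)), hat⟩, hax, haV⟩
      rw [e, card_sdiff_of_subset, card_pair (fun h => ht₂₁ h.symm), hT4]
      intro a ha
      rw [mem_insert, mem_singleton] at ha
      rcases ha with rfl | rfl
      · exact ht₁T
      · exact ht₂T
    · -- `V ∖ ((E − x) ∖ T') = W' ∖ C`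
      ext a
      constructor
      · intro ha
        rw [mem_sdiff] at ha
        obtain ⟨haV, hnot⟩ := ha
        have haT' : a ∈ T' := by
          by_contra h
          exact hnot (mem_sdiff.2 ⟨hVE haV, h⟩)
        rw [hT', mem_union, mem_insert, mem_singleton] at haT'
        rcases haT' with h | rfl | rfl
        · exact h
        · exact absurd haV (hTV _ ht₁T)
        · exact absurd haV (hTV _ ht₂T)
      · intro ha
        rw [mem_sdiff]
        refine ⟨hPV ha, fun h => (mem_sdiff.1 h).2 ?_⟩
        rw [hT', mem_union]
        exact Or.inl ha
  · intro V' hV' W₁ hW₁ W₂ hW₂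
    simp only [Set.mem_setOf_eq, mem_filter] at hW₁ hW₂
    obtain ⟨hCW₁, _, _, _⟩ := hdem' W₁ hW₁.1.1
    obtain ⟨hCW₂, _, _, _⟩ := hdem' W₂ hW₂.1.1
    rw [← sdiff_union_of_subset hCW₁, ← sdiff_union_of_subset hCW₂, ← hW₁.2, ← hW₂.2]

end Core

end PercRepro.Cogirth
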